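import Summits.AnomalousDissipation.AnomalousDissipation.Theorems.SolenoidalFractalHomogenisationLagrangianStepCellLawVOddGainDefectSecondMoment
import Summits.AnomalousDissipation.AnomalousDissipation.Theorems.SolenoidalFractalHomogenisationLagrangianStepCellLawVQSPinchSectorial
import HarnessLib

/-!
# K1L `LagrangianRenormalisationStep(Design)` (K1L_D, stmt-AnomalousDissipation-27980; aside 24912), stub `stub_cellLawV0_IS`
# — W5 window for SECTORIAL backgrounds, SECOND ORDER in `τ`: both halves of the quasi-static window from arithmetic with `O(τ²)` loss
# (helper; `--supports stmt-AnomalousDissipation-27980`)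

Summits-side helper file of route `SolenoidalFractalHomogenisation` (prover seat `ad-k1l-cellLawV-w1` g2), on top of `…OddGainDefectSecondMoment`
(`qsRespMoment2_le`) and `…CellLawVQSPinchSectorial` (p656003).  The first-order design corollaries (`oddSectorial_excQS_of_design` p655589,
`le_symb_excQS_of_design` p656003) lose `τ·hi³/(2lo²)` relative at the lower edge; here the lower edge is the SECOND-ORDER one:
* `sector_form_qsResp_of_lowerBound` — response sector `τ'` from ANY non-negative lower edge `m` with `τ·hi·g_T(lo) ≤ τ'·m`;
* `lowerEdge_second_order_closed` — `xᵀf_T(B)x ≥ ((ϑ_∞ − 2/(ρ(T₀hi)²))/hi − (τhi)²ϑ_∞/(4lo³))|x|²` (`0 < T₀ ≤ T`);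
* **`oddSectorial_excQS_of_design₂`** — for `W₀`: `y ≤ m₂`, `ϑ_∞/lo ≤ c·y`, `τ·hi·ϑ_∞/lo² ≤ τ'·m₂` with
  `m₂ = (ϑ_∞ − 2/(ρ₀(T₀hi)²))/hi − (τhi)²ϑ_∞/(4lo³)` ⇒ `NearIso S lo hi ∧ OddSectorial S τ → OddSectorial (excQS W₀ M S) ((c√5/3)·τ')`
  (read-off `κ ≈ 0.745·ΛV⁶/(1 − τ₀²ΛV⁶/4)`: the `τ₀`-dependence of the first-order table is gone);
* **`le_symb_excQS_of_design₂`** — every word: `(τhi)²ϑ_∞/(4lo³) + 2/(ρ(T₀hi)²)/hi ≤ δ·ϑ_∞/hi` ⇒ `(1 − δ)·gainForm W M hi q p/hi ≤ symb (excQS W M S) q p`.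
Everything PROVED, no definition, no named fact, no sorry.  Infrastructure for route-1's rung leaf F-D1.A0 (frontier FORMAL rung); NOT a proof of the
stub, of the crux, of Onsager's conjecture or of anomalous dissipation.  Prover seat `ad-k1l-cellLawV-w1` g2, 2026-08-28.
-/

set_option linter.dupNamespace false

noncomputable section

namespace Summit.AnomalousDissipation.AnomalousDissipation.Theorems.SolenoidalFractalHomogenisation.LagrangianStep.OddGain

open Matrix Finset MeasureTheory Set
open Literature.Analysis Literature.Analysis.FunctionSpaces Literature.Analysis.FluidPDE
open Literature.Analysis.FluidPDE.LatticeShear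

/-! ## §9 Second-order design corollaries: the odd and even halves of the quasi-static window from arithmetic, loss `O(τ²)` -/

section SecondOrderDesign

variable {k : ℕ}

/-- **Response sector from ANY non-negative lower edge** (generalises `sector_form_qsResp_of_sectorial`, p655074): if `m ≥ 0`,
`m|x|² ≤ xᵀf_T(B)x` for all `x`, and `τ·hi·g_T(lo) ≤ τ'·m`, then the form of `f_T(B)` is in the Kato sector `τ'`. [folklore] -/
theorem sector_form_qsResp_of_lowerBound {ρ T : ℝ} (hT : 0 ≤ T) {B : Matrix (Fin 3) (Fin 3) ℝ} {τ lo hi τ' m : ℝ} (hτ : 0 ≤ τ)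
    (hlo : 0 < lo)
    (hsec : ∀ x z : Fin 3 → ℝ, (x ⬝ᵥ B *ᵥ z - z ⬝ᵥ B *ᵥ x) ^ 2 ≤ τ ^ 2 * ((x ⬝ᵥ B *ᵥ x) * (z ⬝ᵥ B *ᵥ z)))
    (hwin : ∀ x : Fin 3 → ℝ, lo * (x ⬝ᵥ x) ≤ x ⬝ᵥ B *ᵥ x ∧ x ⬝ᵥ B *ᵥ x ≤ hi * (x ⬝ᵥ x))
    (hm0 : 0 ≤ m) (hm : ∀ x : Fin 3 → ℝ, m * (x ⬝ᵥ x) ≤ x ⬝ᵥ (qsResp ρ T B) *ᵥ x)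
    (hgrow : τ * hi * qsRespMoment ρ T lo ≤ τ' * m) (x z : Fin 3 → ℝ) :
    (x ⬝ᵥ (qsResp ρ T B) *ᵥ z - z ⬝ᵥ (qsResp ρ T B) *ᵥ x) ^ 2 ≤
      τ' ^ 2 * ((x ⬝ᵥ (qsResp ρ T B) *ᵥ x) * (z ⬝ᵥ (qsResp ρ T B) *ᵥ z)) := by
  set K := τ * hi * qsRespMoment ρ T lo with hKdef
  have hlohi : lo ≤ hi := lo_le_hi_of_window hwin
  have hK : 0 ≤ K := mul_nonneg (mul_nonneg hτ (hlo.le.trans hlohi)) (qsRespMoment_nonneg ρ hT lo)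
  have hxx : 0 ≤ x ⬝ᵥ x := by rw [self_dotProduct_eq_sum_sq]; exact Finset.sum_nonneg fun i _ => sq_nonneg _
  have hzz : 0 ≤ z ⬝ᵥ z := by rw [self_dotProduct_eq_sum_sq]; exact Finset.sum_nonneg fun i _ => sq_nonneg _
  have hD : |x ⬝ᵥ (qsResp ρ T B) *ᵥ z - z ⬝ᵥ (qsResp ρ T B) *ᵥ x| ≤ K * (Real.sqrt (x ⬝ᵥ x) * Real.sqrt (z ⬝ᵥ z)) :=
    abs_form_qsResp_sub_comm_le (ρ := ρ) hT hτ hlo hsec hwin x z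
  have hD2 : (x ⬝ᵥ (qsResp ρ T B) *ᵥ z - z ⬝ᵥ (qsResp ρ T B) *ᵥ x) ^ 2 ≤ K ^ 2 * ((x ⬝ᵥ x) * (z ⬝ᵥ z)) := by
    have h2 := pow_le_pow_left₀ (abs_nonneg _) hD 2
    rw [sq_abs] at h2
    calc _ ≤ (K * (Real.sqrt (x ⬝ᵥ x) * Real.sqrt (z ⬝ᵥ z))) ^ 2 := h2
      _ = K ^ 2 * ((x ⬝ᵥ x) * (z ⬝ᵥ z)) := by
          rw [mul_pow K, mul_pow (Real.sqrt (x ⬝ᵥ x)), Real.sq_sqrt hxx, Real.sq_sqrt hzz]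
  have hmx : 0 ≤ m * (x ⬝ᵥ x) := mul_nonneg hm0 hxx
  have hmz : 0 ≤ m * (z ⬝ᵥ z) := mul_nonneg hm0 hzz
  calc (x ⬝ᵥ (qsResp ρ T B) *ᵥ z - z ⬝ᵥ (qsResp ρ T B) *ᵥ x) ^ 2 ≤ K ^ 2 * ((x ⬝ᵥ x) * (z ⬝ᵥ z)) := hD2
    _ ≤ (τ' * m) ^ 2 * ((x ⬝ᵥ x) * (z ⬝ᵥ z)) :=
        mul_le_mul_of_nonneg_right (pow_le_pow_left₀ hK hgrow 2) (mul_nonneg hxx hzz)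
    _ = τ' ^ 2 * ((m * (x ⬝ᵥ x)) * (m * (z ⬝ᵥ z))) := by ring
    _ ≤ τ' ^ 2 * ((x ⬝ᵥ (qsResp ρ T B) *ᵥ x) * (z ⬝ᵥ (qsResp ρ T B) *ᵥ z)) :=
        mul_le_mul_of_nonneg_left (mul_le_mul (hm x) (hm z) hmz (hmx.trans (hm x))) (sq_nonneg _)

/-- The SECOND-ORDER lower edge in closed form: `xᵀf_T(B)x ≥ ((ϑ_∞ − 2/(ρ(T₀hi)²))/hi − (τhi)²ϑ_∞/(4lo³))·|x|²` for a sectorial block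
(`lowerEdge_second_order` p654671, `le_qsRespScalar` p655589, `qsRespMoment2_le`; `0 < T₀ ≤ T`, `0 < ρ ≤ 1/2`). [folklore] -/
theorem lowerEdge_second_order_closed {ρ T T₀ : ℝ} (hρ : 0 < ρ) (hρ2 : ρ ≤ 1 / 2) (hT₀ : 0 < T₀) (hT : T₀ ≤ T)
    {B : Matrix (Fin 3) (Fin 3) ℝ} {τ lo hi : ℝ} (hτ : 0 ≤ τ) (hlo : 0 < lo) (hhi : 0 < hi)
    (hsec : ∀ x z : Fin 3 → ℝ, (x ⬝ᵥ B *ᵥ z - z ⬝ᵥ B *ᵥ x) ^ 2 ≤ τ ^ 2 * ((x ⬝ᵥ B *ᵥ x) * (z ⬝ᵥ B *ᵥ z)))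
    (hwin : ∀ x : Fin 3 → ℝ, lo * (x ⬝ᵥ x) ≤ x ⬝ᵥ B *ᵥ x ∧ x ⬝ᵥ B *ᵥ x ≤ hi * (x ⬝ᵥ x)) (x : Fin 3 → ℝ) :
    ((1 - 4 * ρ / 3 - 2 / (ρ * (T₀ * hi) ^ 2)) / hi - (τ * hi) ^ 2 * (1 - 4 * ρ / 3) / (4 * lo ^ 3)) * (x ⬝ᵥ x) ≤
      x ⬝ᵥ (qsResp ρ T B) *ᵥ x := by
  have hTpos : 0 < T := hT₀.trans_le hT
  have hxx : 0 ≤ x ⬝ᵥ x := by rw [self_dotProduct_eq_sum_sq]; exact Finset.sum_nonneg fun i _ => sq_nonneg _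
  have h2 := lowerEdge_second_order (ρ := ρ) hTpos.le hτ hlo hsec hwin x
  have hh := qsRespMoment2_le hρ hρ2 hTpos.le hlo
  have hfhi : (1 - 4 * ρ / 3 - 2 / (ρ * (T₀ * hi) ^ 2)) / hi ≤ qsRespScalar ρ T hi := by
    refine le_trans ?_ (le_qsRespScalar hρ hρ2 hTpos hhi)
    refine div_le_div_of_nonneg_right ?_ hhi.le
    have hmono : 2 / (ρ * (T * hi) ^ 2) ≤ 2 / (ρ * (T₀ * hi) ^ 2) := by
      refine div_le_div_of_nonneg_left (by norm_num) (by positivity) ?_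
      refine mul_le_mul_of_nonneg_left ?_ hρ.le
      exact pow_le_pow_left₀ (by positivity) (mul_le_mul_of_nonneg_right hT hhi.le) 2
    linarith
  have hloss : (τ * hi) ^ 2 / 8 * (T * ∫ s in (0:ℝ)..1, LatticeShear.LatticeWord.trapezoid 0 1 ρ s *
      ∫ x in (0:ℝ)..s, LatticeShear.LatticeWord.trapezoid 0 1 ρ x * ((T * (s - x)) ^ 2 * Real.exp (-(T * (s - x)) * lo))) ≤
      (τ * hi) ^ 2 * (1 - 4 * ρ / 3) / (4 * lo ^ 3) := by
    have := mul_le_mul_of_nonneg_left hh (by positivity : 0 ≤ (τ * hi) ^ 2 / 8)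
    calc _ ≤ (τ * hi) ^ 2 / 8 * (2 * (1 - 4 * ρ / 3) / lo ^ 3) := this
      _ = (τ * hi) ^ 2 * (1 - 4 * ρ / 3) / (4 * lo ^ 3) := by ring
  nlinarith [mul_le_mul_of_nonneg_right (sub_le_sub hfhi hloss) hxx]

/-- **THE ODD HALF OF THE QUASI-STATIC W5 WINDOW FROM ARITHMETIC, SECOND ORDER IN `τ`** (`oddSectorial_excQS_of_design` with the lower edge
`m₂ = (ϑ_∞ − ε₀)/hi − (τhi)²ϑ_∞/(4lo³)` in place of `(ϑ_∞ − ε₀)/hi − (τhi/2)ϑ_∞/lo²`): for `W₀` (`ρ₀ = 1/2`, `ϑ_∞ = 1/3`), `M ≥ 0`,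
`0 < lo ≤ 1 ≤ hi`, `τ, τ' ≥ 0`, box `[y, c·y]`, `T₀ > 0` below the slot relaxations: `y ≤ m₂`, `ϑ_∞/lo ≤ c·y`, `τ·hi·ϑ_∞/lo² ≤ τ'·m₂` ⇒
`NearIso S lo hi ∧ OddSectorial S τ → OddSectorial (excQS W₀ M S) ((c√5/3)·τ')`.  Read-off: `κ ≈ 0.745·ΛV⁶/(1 − τ₀²ΛV⁶/4)`. [folklore] -/
theorem oddSectorial_excQS_of_design₂ (Mlag : ℝ) {lo hi τ τ' y c T₀ : ℝ} (hlo : 0 < lo) (hlo1 : lo ≤ 1) (hhi1 : 1 ≤ hi)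
    (hy : 0 ≤ y) (hc : 0 ≤ c) (hτ : 0 ≤ τ) (hτ' : 0 ≤ τ') (hT₀ : 0 < T₀)
    (hTs : ∀ s : Fin 26, T₀ ≤ 4 * Real.pi ^ 2 * ‖Torus.latticeVec (cubatureWord.phase s).m‖ ^ 2 * Mlag * (cubatureWord.phase s).τ)
    (h1 : y ≤ (1 - 4 * cubatureWord.ramp / 3 - 2 / (cubatureWord.ramp * (T₀ * hi) ^ 2)) / hi -
      (τ * hi) ^ 2 * (1 - 4 * cubatureWord.ramp / 3) / (4 * lo ^ 3))
    (h2 : (1 - 4 * cubatureWord.ramp / 3) / lo ≤ c * y)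
    (h3 : τ * hi * ((1 - 4 * cubatureWord.ramp / 3) / lo ^ 2) ≤
      τ' * ((1 - 4 * cubatureWord.ramp / 3 - 2 / (cubatureWord.ramp * (T₀ * hi) ^ 2)) / hi -
        (τ * hi) ^ 2 * (1 - 4 * cubatureWord.ramp / 3) / (4 * lo ^ 3)))
    {S : Torus.Visc4 (Fin 3)} (hS : Torus.NearIso S lo hi) (hodd : OddSectorial S τ) :
    OddSectorial (excQS cubatureWord Mlag S) (c * Real.sqrt 5 / 3 * τ') := by
  have hρ := cubatureWord.ramp_pos
  have hρ2 := cubatureWord.ramp_le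
  have hhi : 0 < hi := by linarith
  have hτhi : 0 ≤ τ * hi := mul_nonneg hτ hhi.le
  set m₂ := (1 - 4 * cubatureWord.ramp / 3 - 2 / (cubatureWord.ramp * (T₀ * hi) ^ 2)) / hi -
      (τ * hi) ^ 2 * (1 - 4 * cubatureWord.ramp / 3) / (4 * lo ^ 3) with hm₂
  have hm₂0 : 0 ≤ m₂ := hy.trans h1
  have hform : ∀ s (x z : Fin 3 → ℝ), x ⬝ᵥ (slotQ cubatureWord Mlag S s) *ᵥ z =
      ((projPerp (slotN s)) *ᵥ x) ⬝ᵥ (qsResp cubatureWord.ramp (4 * Real.pi ^ 2 * ‖Torus.latticeVec (cubatureWord.phase s).m‖ ^ 2 *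
        Mlag * (cubatureWord.phase s).τ) (regBlock S (slotN s))) *ᵥ ((projPerp (slotN s)) *ᵥ z) := by
    intro s x z
    rw [← sum_sum_eq_form, slotQ_form_eq, slotN]
  have hsecB : ∀ s : Fin 26, ∀ x z : Fin 3 → ℝ, (x ⬝ᵥ (regBlock S (slotN s)) *ᵥ z - z ⬝ᵥ (regBlock S (slotN s)) *ᵥ x) ^ 2 ≤
      τ ^ 2 * ((x ⬝ᵥ (regBlock S (slotN s)) *ᵥ x) * (z ⬝ᵥ (regBlock S (slotN s)) *ᵥ z)) :=
    fun s => sectorForm_regBlock (sum_mhat_sq _) hS hlo.le hodd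
  have hwinB : ∀ s : Fin 26, ∀ x : Fin 3 → ℝ, lo * (x ⬝ᵥ x) ≤ x ⬝ᵥ (regBlock S (slotN s)) *ᵥ x ∧
      x ⬝ᵥ (regBlock S (slotN s)) *ᵥ x ≤ hi * (x ⬝ᵥ x) :=
    fun s => window_regBlock (sum_mhat_sq _) hS hlo1 hhi1
  refine oddSectorial_excQS_strict Mlag S hy hc hτ' (fun s x z => ?_) (fun s x => ?_)
  · have hT := hTs s
    have hTpos := hT₀.trans_le hT
    rw [hform, hform, hform, hform]
    refine sector_form_qsResp_of_lowerBound hTpos.le hτ hlo (hsecB s) (hwinB s) hm₂0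
      (fun x => lowerEdge_second_order_closed hρ hρ2 hT₀ hT hτ hlo hhi (hsecB s) (hwinB s) x) ?_ _ _
    calc τ * hi * qsRespMoment cubatureWord.ramp _ lo ≤ τ * hi * ((1 - 4 * cubatureWord.ramp / 3) / lo ^ 2) :=
          mul_le_mul_of_nonneg_left (qsRespMoment_le hρ hρ2 hTpos.le hlo) hτhi
      _ ≤ τ' * m₂ := h3
  · have hT := hTs s
    have hTpos := hT₀.trans_le hT
    have hn : ∑ a, slotN s a ^ 2 = 1 := by rw [← self_dotProduct_eq_sum_sq]; exact slotN_unit s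
    have hQ : 0 ≤ ((projPerp (slotN s)) *ᵥ x) ⬝ᵥ ((projPerp (slotN s)) *ᵥ x) := by
      rw [self_dotProduct_eq_sum_sq]; exact Finset.sum_nonneg fun i _ => sq_nonneg _
    rw [hform, ← perpSq_eq_projPerp (slotN s) x hn]
    constructor
    · exact (mul_le_mul_of_nonneg_right h1 hQ).trans (lowerEdge_second_order_closed hρ hρ2 hT₀ hT hτ hlo hhi (hsecB s) (hwinB s) _)
    · calc _ ≤ qsRespScalar cubatureWord.ramp _ lo * (((projPerp (slotN s)) *ᵥ x) ⬝ᵥ ((projPerp (slotN s)) *ᵥ x)) :=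
            qsResp_window_upper hTpos.le (fun x => (hwinB s x).1) _
        _ ≤ (1 - 4 * cubatureWord.ramp / 3) / lo * (((projPerp (slotN s)) *ᵥ x) ⬝ᵥ ((projPerp (slotN s)) *ᵥ x)) :=
            mul_le_mul_of_nonneg_right (qsRespScalar_le hρ hρ2 hTpos.le hlo) hQ
        _ ≤ c * y * (((projPerp (slotN s)) *ᵥ x) ⬝ᵥ ((projPerp (slotN s)) *ᵥ x)) := mul_le_mul_of_nonneg_right h2 hQ

/-- **LOWER HALF OF THE EVEN PINCH FROM ARITHMETIC, SECOND ORDER IN `τ`** (`le_symb_excQS_of_design` p656003 with the `O(τ²)` edge): for every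
word `W` (`ρ = W.ramp`, `ϑ_∞ = 1 − 4ρ/3`), `M ≥ 0`, `0 < lo ≤ 1 ≤ hi`, `τ ≥ 0`, `0 ≤ δ ≤ 1`, `T₀ > 0` below the slot relaxations:
`(τhi)²ϑ_∞/(4lo³) + 2/(ρ(T₀hi)²hi) ≤ δ·ϑ_∞/hi` ⇒ `(1 − δ)·gainForm W M hi q p / hi ≤ symb (excQS W M S) q p`. [folklore] -/
theorem le_symb_excQS_of_design₂ (W : LatticeShear.LatticeWord k) {M : ℝ} {S : Torus.Visc4 (Fin 3)} {lo hi τ δ T₀ : ℝ}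
    (hlo : 0 < lo) (hlo1 : lo ≤ 1) (hhi1 : 1 ≤ hi) (hτ : 0 ≤ τ) (hδ1 : δ ≤ 1) (hT₀ : 0 < T₀)
    (hTs : ∀ s : Fin k, T₀ ≤ 4 * Real.pi ^ 2 * ‖Torus.latticeVec (W.phase s).m‖ ^ 2 * M * (W.phase s).τ)
    (hδ : (τ * hi) ^ 2 * (1 - 4 * W.ramp / 3) / (4 * lo ^ 3) + 2 / (W.ramp * (T₀ * hi) ^ 2) / hi ≤ δ * ((1 - 4 * W.ramp / 3) / hi))
    (hS : Torus.NearIso S lo hi) (hodd : OddSectorial S τ) (q p : Fin 3 → ℝ) :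
    (1 - δ) * (gainForm W M hi q p / hi) ≤ Torus.symb (excQS W M S) q p := by
  have hρ := W.ramp_pos
  have hρ2 := W.ramp_le
  have hhi : 0 < hi := by linarith
  rw [symb_excQS, gainForm_div W M hhi.ne' q p, Finset.mul_sum]
  refine Finset.sum_le_sum fun s _ => ?_
  have hn := sum_mhat_sq (W.phase s)
  have hT := hTs s
  have hTpos := hT₀.trans_le hT
  have hcoef : 0 ≤ slotCoef W s * (∑ a, (W.phase s).e a * q a) ^ 2 := mul_nonneg (slotCoef_nonneg W s) (sq_nonneg _)
  have hP : 0 ≤ ∑ i, p i ^ 2 - (∑ i, p i * mhat (W.phase s) i) ^ 2 := by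
    rw [← sum_sq_projPerp_mulVec hn p]; exact Finset.sum_nonneg fun i _ => sq_nonneg _
  have hlow := lowerEdge_second_order_closed hρ hρ2 hT₀ hT hτ hlo hhi (sectorForm_regBlock hn hS hlo.le hodd)
    (window_regBlock hn hS hlo1 hhi1) ((projPerp (mhat (W.phase s))) *ᵥ p)
  rw [dotProduct_projPerp_self_eq hn p] at hlow
  have hfup : qsRespScalar W.ramp (4 * Real.pi ^ 2 * ‖Torus.latticeVec (W.phase s).m‖ ^ 2 * M * (W.phase s).τ) hi ≤
      (1 - 4 * W.ramp / 3) / hi := qsRespScalar_le hρ hρ2 hTpos.le hhi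
  have hedge : (1 - δ) * qsRespScalar W.ramp (4 * Real.pi ^ 2 * ‖Torus.latticeVec (W.phase s).m‖ ^ 2 * M * (W.phase s).τ) hi ≤
      (1 - 4 * W.ramp / 3 - 2 / (W.ramp * (T₀ * hi) ^ 2)) / hi - (τ * hi) ^ 2 * (1 - 4 * W.ramp / 3) / (4 * lo ^ 3) := by
    have h1 := mul_le_mul_of_nonneg_left hfup (sub_nonneg.2 hδ1)
    have e : (1 - 4 * W.ramp / 3 - 2 / (W.ramp * (T₀ * hi) ^ 2)) / hi =
        (1 - 4 * W.ramp / 3) / hi - 2 / (W.ramp * (T₀ * hi) ^ 2) / hi := by ring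
    rw [e]
    linarith
  rw [slotQ_form_eq]
  calc (1 - δ) * (slotCoef W s * (∑ a, (W.phase s).e a * q a) ^ 2 *
        (qsRespScalar W.ramp (4 * Real.pi ^ 2 * ‖Torus.latticeVec (W.phase s).m‖ ^ 2 * M * (W.phase s).τ) hi *
          (∑ i, p i ^ 2 - (∑ i, p i * mhat (W.phase s) i) ^ 2)))
      = slotCoef W s * (∑ a, (W.phase s).e a * q a) ^ 2 *
          (((1 - δ) * qsRespScalar W.ramp (4 * Real.pi ^ 2 * ‖Torus.latticeVec (W.phase s).m‖ ^ 2 * M * (W.phase s).τ) hi) *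
            (∑ i, p i ^ 2 - (∑ i, p i * mhat (W.phase s) i) ^ 2)) := by ring
    _ ≤ slotCoef W s * (∑ a, (W.phase s).e a * q a) ^ 2 *
          (((1 - 4 * W.ramp / 3 - 2 / (W.ramp * (T₀ * hi) ^ 2)) / hi - (τ * hi) ^ 2 * (1 - 4 * W.ramp / 3) / (4 * lo ^ 3)) *
            (∑ i, p i ^ 2 - (∑ i, p i * mhat (W.phase s) i) ^ 2)) :=
        mul_le_mul_of_nonneg_left (mul_le_mul_of_nonneg_right hedge hP) hcoef
    _ ≤ _ := mul_le_mul_of_nonneg_left hlow hcoef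

/-- **THE QUASI-STATIC EXCESS CONTRACTS THE KATO SECTOR — explicit gain `κ(lo, hi, τ₀, T₀)`, no free parameters.**  For `W₀`
(`ρ₀ = W₀.ramp`, `ϑ_∞ = 1 − 4ρ₀/3`), any `M`, a window `0 < lo ≤ 1 ≤ hi`, a maximal half-angle `τ₀` and `T₀ > 0` below the slot
relaxations, put `m₂ := (ϑ_∞ − 2/(ρ₀(T₀hi)²))/hi − (τ₀hi)²ϑ_∞/(4lo³)` and assume `m₂ > 0`.  Then for EVERY `τ ∈ [0, τ₀]` and every background `S`
with `NearIso S lo hi`, `OddSectorial S τ`:  `OddSectorial (excQS W₀ M S) (κ·τ)` with `κ = (ϑ_∞/(lo·m₂))·(√5/3)·(hi·ϑ_∞/(lo²·m₂))`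
(`oddSectorial_excQS_of_design₂` at `y = m₂`, `c = ϑ_∞/(lo·m₂)`, `τ' = τ·hi·ϑ_∞/(lo²·m₂)`).  This is the shape of `SectorialOddChannelBoundOn`
(p645711) with source `ε = 0`, for the quasi-static map `S ↦ excQS W₀ M S` in the `NearIso` currency; `κ → (√5/3)(hi/lo)³ = 0.745·ΛV⁶` as
`T₀ → ∞`, `τ₀ → 0` for the window `[1/ΛV, ΛV]`. [folklore] -/
theorem oddSectorial_excQS_contraction (Mlag : ℝ) {lo hi τ₀ T₀ : ℝ} (hlo : 0 < lo) (hlo1 : lo ≤ 1) (hhi1 : 1 ≤ hi)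
    (hT₀ : 0 < T₀)
    (hTs : ∀ s : Fin 26, T₀ ≤ 4 * Real.pi ^ 2 * ‖Torus.latticeVec (cubatureWord.phase s).m‖ ^ 2 * Mlag * (cubatureWord.phase s).τ)
    (hm : 0 < (1 - 4 * cubatureWord.ramp / 3 - 2 / (cubatureWord.ramp * (T₀ * hi) ^ 2)) / hi -
      (τ₀ * hi) ^ 2 * (1 - 4 * cubatureWord.ramp / 3) / (4 * lo ^ 3))
    {τ : ℝ} (hτ : τ ∈ Set.Icc 0 τ₀) {S : Torus.Visc4 (Fin 3)} (hS : Torus.NearIso S lo hi) (hodd : OddSectorial S τ) :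
    OddSectorial (excQS cubatureWord Mlag S)
      ((1 - 4 * cubatureWord.ramp / 3) / (lo * ((1 - 4 * cubatureWord.ramp / 3 - 2 / (cubatureWord.ramp * (T₀ * hi) ^ 2)) / hi -
          (τ₀ * hi) ^ 2 * (1 - 4 * cubatureWord.ramp / 3) / (4 * lo ^ 3))) * Real.sqrt 5 / 3 *
        (hi * (1 - 4 * cubatureWord.ramp / 3) / (lo ^ 2 * ((1 - 4 * cubatureWord.ramp / 3 - 2 / (cubatureWord.ramp * (T₀ * hi) ^ 2)) / hi -
          (τ₀ * hi) ^ 2 * (1 - 4 * cubatureWord.ramp / 3) / (4 * lo ^ 3)))) * τ) := by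
  set ϑ := 1 - 4 * cubatureWord.ramp / 3 with hϑ
  set y := (ϑ - 2 / (cubatureWord.ramp * (T₀ * hi) ^ 2)) / hi - (τ₀ * hi) ^ 2 * ϑ / (4 * lo ^ 3) with hydef
  have hρ2 := cubatureWord.ramp_le
  have hϑ0 : 0 < ϑ := by rw [hϑ]; linarith
  have hhi : 0 < hi := by linarith
  have hy : 0 < y := hm
  have hτ0 : 0 ≤ τ := hτ.1
  -- the τ-dependent edge dominates the τ₀-edge
  have hmono : y ≤ (ϑ - 2 / (cubatureWord.ramp * (T₀ * hi) ^ 2)) / hi - (τ * hi) ^ 2 * ϑ / (4 * lo ^ 3) := by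
    have hsq : (τ * hi) ^ 2 ≤ (τ₀ * hi) ^ 2 := pow_le_pow_left₀ (by positivity) (mul_le_mul_of_nonneg_right hτ.2 hhi.le) 2
    have : (τ * hi) ^ 2 * ϑ / (4 * lo ^ 3) ≤ (τ₀ * hi) ^ 2 * ϑ / (4 * lo ^ 3) :=
      div_le_div_of_nonneg_right (mul_le_mul_of_nonneg_right hsq hϑ0.le) (by positivity)
    rw [hydef]; linarith
  have hc : 0 ≤ ϑ / (lo * y) := by positivity
  have hτ' : 0 ≤ τ * hi * ϑ / (lo ^ 2 * y) := by positivity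
  have h2 : (1 - 4 * cubatureWord.ramp / 3) / lo ≤ ϑ / (lo * y) * y := by
    rw [← hϑ]
    exact le_of_eq (by field_simp)
  have h := oddSectorial_excQS_of_design₂ Mlag hlo hlo1 hhi1 hy.le hc hτ0 hτ' hT₀ hTs hmono h2 ?_ hS hodd
  · have e : ϑ / (lo * y) * Real.sqrt 5 / 3 * (τ * hi * ϑ / (lo ^ 2 * y)) =
        ϑ / (lo * y) * Real.sqrt 5 / 3 * (hi * ϑ / (lo ^ 2 * y)) * τ := by ring
    rw [e] at h
    exact h
  · calc τ * hi * (ϑ / lo ^ 2) = τ * hi * ϑ / (lo ^ 2 * y) * y := by field_simp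
      _ ≤ τ * hi * ϑ / (lo ^ 2 * y) * ((ϑ - 2 / (cubatureWord.ramp * (T₀ * hi) ^ 2)) / hi - (τ * hi) ^ 2 * ϑ / (4 * lo ^ 3)) :=
          mul_le_mul_of_nonneg_left hmono hτ'

end SecondOrderDesign

end Summit.AnomalousDissipation.AnomalousDissipation.Theorems.SolenoidalFractalHomogenisation.LagrangianStep.OddGain

end
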